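import Summits.QuantumFields.BalabanUV.Beta.EriceRemainderEnclosureHistoryAutonomyComparisonAgeCompositionFiveAgesOneBlock
import Summits.QuantumFields.BalabanUV.Beta.EriceRemainderEnclosureHistoryAutonomyComparisonAgeCompositionOldTripleCapC28
import Summits.QuantumFields.BalabanUV.Beta.EriceRemainderEnclosureHistoryAutonomyComparisonAgeCompositionOldTripleCapC82
import Summits.QuantumFields.BalabanUV.Beta.EriceRemainderEnclosureHistoryAutonomyComparisonAgeCompositionOldTripleCapC38
import Summits.QuantumFields.BalabanUV.Beta.EriceRemainderEnclosureHistoryAutonomyComparisonAgeCompositionOldTripleCapC83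
import Summits.QuantumFields.BalabanUV.Beta.EriceRemainderEnclosureHistoryAutonomyComparisonAgeCompositionOldTripleCapC48
import Summits.QuantumFields.BalabanUV.Beta.EriceRemainderEnclosureHistoryAutonomyComparisonAgeCompositionOldTripleCapC84
import Summits.QuantumFields.BalabanUV.Beta.EriceRemainderEnclosureHistoryAutonomyComparisonAgeCompositionOldTripleCapC88

/-!
# EriceRemainderEnclosureHistoryAutonomyComparisonAgeCompositionFiveAgesOneBlockWide — (E104b) route (N), first order: THE CENSUS FIVE AGES `{1, k₂, k₃, k₄, k₅}`, A TOP RATIO IN (4, 8].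
# The cascade's last step is cheap ((E99g) `flow_nonneg_two_cluster_levels_of_caps`: a capped youngest cluster and ONE capped top cluster close with
# `s₀(ρ₀λ + 4s(1+κ) + κ) ≤ ρ₀λ`, `λ = 1 − s(1+κ)`, any `κ > 0`).  With the youngest cluster the census young pair `{1, k₂}` (`k₂ ≤ 29`, cap `0.8333`,
# (E97c)) and the top cluster the OLD TRIPLE `{k₃, k₄, k₅}` capped by the cell tables of (E103e–zb), the census five ages hold along every admissible flow
# for EVERY `(k₄∕k₃, k₅∕k₄)` in the cell once `k₃ ≥ ρ₀·k₂`, `ρ₀ = ⌈0.8333(4s(1+κ)+κ)∕(λ·0.1667)⌉` at `κ = 1∕1000`: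
# # `flow_nonneg_census_five_ages_c28` (ρ₀ = 86); `flow_nonneg_census_five_ages_c82` (ρ₀ = 92); `flow_nonneg_census_five_ages_c38` (ρ₀ = 92); `flow_nonneg_census_five_ages_c83` (ρ₀ = 106); `flow_nonneg_census_five_ages_c48` (ρ₀ = 106); `flow_nonneg_census_five_ages_c84` (ρ₀ = 115); `flow_nonneg_census_five_ages_c88` (ρ₀ = 233);
# **`flow_nonneg_census_five_ages_top8`**: EVERY `k₃ < k₄ ≤ 8k₃`, `k₄ < k₅ ≤ 8k₄` once `233k₂ ≤ k₃`.
# (numerics `HOME/b2b-balaban-beta-d4-p2/g89/numerics/five_certified.py`: the adaptive engine (E101) with three separate old levels would lower the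
# larger `ρ₀` of the wide cells to `≈ 45–75`; not typed here).

Cell `pub-balaban`, β-function sub-cell, BINDER row D4 «RemainderConst leaves for Bałaban's split» (`HOME/BINDER-OWNERS.md`; owner lineage `b2b-balaban-beta-an4`;
this file by co-owner #2 lineage `b2b-balaban-beta-d4-p2`, generation 89), β-FLOW TEAM duty (1), FREEZE (0) honoured (def-free; nothing restated).

HONEST FRAMING (page 1, verbatim and binding).  *"Discharging BetaPertH makes Bałaban's UV stability UNCONDITIONAL — a real constructive-QFT result; it is
NOT the continuum limit and NOT the Clay problem."*  THIS FILE DISCHARGES NOTHING OF THE KIND.  Elementary real algebra ∕ real analysis about ABSTRACT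
functionals on a box ]0,γ]^ℕ with displayed floors, profiles and signs, and the FIRST-ORDER renewal objects of route (N) built from them — hypotheses of a
census, not facts; the form, signs, ages and moments of Bałaban's (1.22) limit functional are NOT PRINTED ([I] p. 298; GAPS G-t4-U2-1∕-2) and NOT asserted.
Row D4 class UNCHANGED (critical-path width 0; instance 0∕1; D4 DISCHARGE NO DATE).  HONEST DEPENDENCY: continuum YM on T⁴ ⇐ BetaPertH ∧ nine spine
estimates (0/9 proved); BetaPertH ⇐ (D1) ∧ (D4) ∧ CAP+tail; G-an2-4 gates asym, D1 and NE2/3/4.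

THE POINT (README `HOME/b2b-balaban-beta-d4-p2/g89/README.md` §4).  Uses (E104a) `flow_nonneg_census_young_pair_old_triple_of_cap`, `flow_nonneg_census_five_ages_top4`, (E103n–t) `old_triple_load_le_c28 … c88` BY NAME.  NOT CLAIMED: `k₂ ≥ 30`; `k₃ < ρ₀k₂`; the cell `(8,16]²`; six or
more ages; anything printed — NOT B12 Thm 2, NOT BetaPertH, NOT continuum, NOT Clay.

WHAT IS PROVED ([folklore]; 0 `def`, 0 sorry).  See the list above.
-/
noncomputable section
open Finset

namespace Summit.QuantumFields.BalabanUV.Beta.EriceRemainderEnclosureHistoryAutonomyComparisonAgeCompositionFiveAgesOneBlockWide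

open Literature.MathematicalPhysics.QuantumFieldTheory.Balaban1983to89
open Literature.MathematicalPhysics.QuantumFieldTheory.Balaban1983to89.T4BetaStationary
open Literature.MathematicalPhysics.QuantumFieldTheory.Balaban1983to89.T4BetaFlowWellPosed
open Summit.QuantumFields.BalabanUV.Beta.EriceRemainderEnclosureHistoryAutonomyComparisonAgeCompositionFiveAgesOneBlock
open Summit.QuantumFields.BalabanUV.Beta.EriceRemainderEnclosureHistoryAutonomyComparisonAgeCompositionOldTripleCapC28 (old_triple_load_le_c28)
open Summit.QuantumFields.BalabanUV.Beta.EriceRemainderEnclosureHistoryAutonomyComparisonAgeCompositionOldTripleCapC82 (old_triple_load_le_c82)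
open Summit.QuantumFields.BalabanUV.Beta.EriceRemainderEnclosureHistoryAutonomyComparisonAgeCompositionOldTripleCapC38 (old_triple_load_le_c38)
open Summit.QuantumFields.BalabanUV.Beta.EriceRemainderEnclosureHistoryAutonomyComparisonAgeCompositionOldTripleCapC83 (old_triple_load_le_c83)
open Summit.QuantumFields.BalabanUV.Beta.EriceRemainderEnclosureHistoryAutonomyComparisonAgeCompositionOldTripleCapC48 (old_triple_load_le_c48)
open Summit.QuantumFields.BalabanUV.Beta.EriceRemainderEnclosureHistoryAutonomyComparisonAgeCompositionOldTripleCapC84 (old_triple_load_le_c84)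
open Summit.QuantumFields.BalabanUV.Beta.EriceRemainderEnclosureHistoryAutonomyComparisonAgeCompositionOldTripleCapC88 (old_triple_load_le_c88)

variable {B : (ℕ → ℝ) → ℝ} {γ b gIR : ℝ} {L : ℕ → ℝ} {K : ℕ} {h g : ℕ → ℝ}

/-! ## §1 The cells with a top ratio in `(4, 8]` -/

/-- **THE CENSUS FIVE AGES `{1, k₂, k₃, k₄, k₅}` ON THE CELL `k₄∕k₃ ∈ (1,2]`, `k₅∕k₄ ∈ (4,8]`:** `2 ≤ k₂ ≤ 29`, `86·k₂ ≤ k₃`: `0 ≤ ε ≤ e` at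
every pin, every horizon, every damping of the self-consistent class (§1 with the triple cap `81 / 100` of `old_triple_load_le_c28`, `κ = 1∕1000`,
`ρ₀ = 86`). [folklore] -/
theorem flow_nonneg_census_five_ages_c28
    (hmono : ∀ u v : ℕ → ℝ, SeqBox γ u → SeqBox γ v → (∀ j, u j ≤ v j) → B u ≤ B v)
    (hL : ∀ k, 0 ≤ L k) (hb : 0 < b) (hlo : ∀ u, SeqBox γ u → b ≤ B u) (hdom : ∀ u, SeqBox γ u → ∑ k ∈ range K, L k * u k ≤ B u)
    (hh : SeqBox γ h) (hf : MemFlow B gIR h) (hg : ∀ t, 0 < g t ∧ g t ≤ 1)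
    (hgF : ∀ t, 1 ≤ g t * (1 + ∑ k ∈ range K, L k * h (t + k) ^ 3 / 2))
    {k₂ k₃ k₄ k₅ : ℕ} (hk2 : 2 ≤ k₂) (hk29 : k₂ ≤ 29) (hk3 : 86 * k₂ ≤ k₃)
    (h34l : 1 * k₃ < k₄) (h34h : k₄ ≤ 2 * k₃) (h45l : 4 * k₄ < k₅) (h45h : k₅ ≤ 8 * k₄) (hk5K : k₅ < K)
    (hLa : ∀ l, l < K → l ≠ 1 → l ≠ k₂ → l ≠ k₃ → l ≠ k₄ → l ≠ k₅ → L l = 0)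
    {N : ℕ} {KL : ℕ → ℕ → ℕ → ℝ}
    (hKL : ∀ k n l, KL k n l = if 0 < k ∧ k < K ∧ l < k then L k * h (n + k) ^ 3 / 2 * ∏ t ∈ Ico (n + 1 + l) (n + k + 1), g t else 0)
    {KA : ℕ → ℕ → ℕ → ℝ} {RA : ℕ → (ℕ → ℝ) → ℕ → ℝ}
    (hRA : ∀ i v m, RA i v m = ∑ l ∈ range K, KA i m l * v (m + 1 + l))
    (hKA : ∀ i m l, KA i m l = KL i m l + KA (i + 1) m l) (hKAtop : ∀ m l, KA K m l = 0)
    {e ε : ℕ → ℝ} (he0 : ∀ m, 0 ≤ e m) (hea : ∀ m, e (m + 1) ≤ e m)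
    (hεt : ∀ m, N < m → ε m = 0) (hεrec : ∀ m, ε m = e m - RA 1 ε m) : ∀ m, 0 ≤ ε m ∧ ε m ≤ e m :=
  flow_nonneg_census_young_pair_old_triple_of_cap hmono hL hb hlo hdom hh hf hg hgF hk2 hk29 (by omega) (by omega) (by omega) hk5K
    (s := 81 / 100) (κ := 1 / 1000) (ρ₀ := 86) (by norm_num) (by norm_num) (by norm_num) (by norm_num) (by norm_num) hk3
    (fun q => old_triple_load_le_c28 hmono hL hb hlo hdom hh hf (by omega) h34l h34h h45l h45h hk5K q) hLa hKL hRA hKA hKAtop he0 hea hεt hεrec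

/-- **THE CENSUS FIVE AGES `{1, k₂, k₃, k₄, k₅}` ON THE CELL `k₄∕k₃ ∈ (4,8]`, `k₅∕k₄ ∈ (1,2]`:** `2 ≤ k₂ ≤ 29`, `92·k₂ ≤ k₃`: `0 ≤ ε ≤ e` at
every pin, every horizon, every damping of the self-consistent class (§1 with the triple cap `41 / 50` of `old_triple_load_le_c82`, `κ = 1∕1000`,
`ρ₀ = 92`). [folklore] -/
theorem flow_nonneg_census_five_ages_c82
    (hmono : ∀ u v : ℕ → ℝ, SeqBox γ u → SeqBox γ v → (∀ j, u j ≤ v j) → B u ≤ B v)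
    (hL : ∀ k, 0 ≤ L k) (hb : 0 < b) (hlo : ∀ u, SeqBox γ u → b ≤ B u) (hdom : ∀ u, SeqBox γ u → ∑ k ∈ range K, L k * u k ≤ B u)
    (hh : SeqBox γ h) (hf : MemFlow B gIR h) (hg : ∀ t, 0 < g t ∧ g t ≤ 1)
    (hgF : ∀ t, 1 ≤ g t * (1 + ∑ k ∈ range K, L k * h (t + k) ^ 3 / 2))
    {k₂ k₃ k₄ k₅ : ℕ} (hk2 : 2 ≤ k₂) (hk29 : k₂ ≤ 29) (hk3 : 92 * k₂ ≤ k₃)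
    (h34l : 4 * k₃ < k₄) (h34h : k₄ ≤ 8 * k₃) (h45l : 1 * k₄ < k₅) (h45h : k₅ ≤ 2 * k₄) (hk5K : k₅ < K)
    (hLa : ∀ l, l < K → l ≠ 1 → l ≠ k₂ → l ≠ k₃ → l ≠ k₄ → l ≠ k₅ → L l = 0)
    {N : ℕ} {KL : ℕ → ℕ → ℕ → ℝ}
    (hKL : ∀ k n l, KL k n l = if 0 < k ∧ k < K ∧ l < k then L k * h (n + k) ^ 3 / 2 * ∏ t ∈ Ico (n + 1 + l) (n + k + 1), g t else 0)
    {KA : ℕ → ℕ → ℕ → ℝ} {RA : ℕ → (ℕ → ℝ) → ℕ → ℝ}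
    (hRA : ∀ i v m, RA i v m = ∑ l ∈ range K, KA i m l * v (m + 1 + l))
    (hKA : ∀ i m l, KA i m l = KL i m l + KA (i + 1) m l) (hKAtop : ∀ m l, KA K m l = 0)
    {e ε : ℕ → ℝ} (he0 : ∀ m, 0 ≤ e m) (hea : ∀ m, e (m + 1) ≤ e m)
    (hεt : ∀ m, N < m → ε m = 0) (hεrec : ∀ m, ε m = e m - RA 1 ε m) : ∀ m, 0 ≤ ε m ∧ ε m ≤ e m :=
  flow_nonneg_census_young_pair_old_triple_of_cap hmono hL hb hlo hdom hh hf hg hgF hk2 hk29 (by omega) (by omega) (by omega) hk5K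
    (s := 41 / 50) (κ := 1 / 1000) (ρ₀ := 92) (by norm_num) (by norm_num) (by norm_num) (by norm_num) (by norm_num) hk3
    (fun q => old_triple_load_le_c82 hmono hL hb hlo hdom hh hf (by omega) h34l h34h h45l h45h hk5K q) hLa hKL hRA hKA hKAtop he0 hea hεt hεrec

/-- **THE CENSUS FIVE AGES `{1, k₂, k₃, k₄, k₅}` ON THE CELL `k₄∕k₃ ∈ (2,3]`, `k₅∕k₄ ∈ (4,8]`:** `2 ≤ k₂ ≤ 29`, `92·k₂ ≤ k₃`: `0 ≤ ε ≤ e` at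
every pin, every horizon, every damping of the self-consistent class (§1 with the triple cap `41 / 50` of `old_triple_load_le_c38`, `κ = 1∕1000`,
`ρ₀ = 92`). [folklore] -/
theorem flow_nonneg_census_five_ages_c38
    (hmono : ∀ u v : ℕ → ℝ, SeqBox γ u → SeqBox γ v → (∀ j, u j ≤ v j) → B u ≤ B v)
    (hL : ∀ k, 0 ≤ L k) (hb : 0 < b) (hlo : ∀ u, SeqBox γ u → b ≤ B u) (hdom : ∀ u, SeqBox γ u → ∑ k ∈ range K, L k * u k ≤ B u)
    (hh : SeqBox γ h) (hf : MemFlow B gIR h) (hg : ∀ t, 0 < g t ∧ g t ≤ 1)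
    (hgF : ∀ t, 1 ≤ g t * (1 + ∑ k ∈ range K, L k * h (t + k) ^ 3 / 2))
    {k₂ k₃ k₄ k₅ : ℕ} (hk2 : 2 ≤ k₂) (hk29 : k₂ ≤ 29) (hk3 : 92 * k₂ ≤ k₃)
    (h34l : 2 * k₃ < k₄) (h34h : k₄ ≤ 3 * k₃) (h45l : 4 * k₄ < k₅) (h45h : k₅ ≤ 8 * k₄) (hk5K : k₅ < K)
    (hLa : ∀ l, l < K → l ≠ 1 → l ≠ k₂ → l ≠ k₃ → l ≠ k₄ → l ≠ k₅ → L l = 0)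
    {N : ℕ} {KL : ℕ → ℕ → ℕ → ℝ}
    (hKL : ∀ k n l, KL k n l = if 0 < k ∧ k < K ∧ l < k then L k * h (n + k) ^ 3 / 2 * ∏ t ∈ Ico (n + 1 + l) (n + k + 1), g t else 0)
    {KA : ℕ → ℕ → ℕ → ℝ} {RA : ℕ → (ℕ → ℝ) → ℕ → ℝ}
    (hRA : ∀ i v m, RA i v m = ∑ l ∈ range K, KA i m l * v (m + 1 + l))
    (hKA : ∀ i m l, KA i m l = KL i m l + KA (i + 1) m l) (hKAtop : ∀ m l, KA K m l = 0)
    {e ε : ℕ → ℝ} (he0 : ∀ m, 0 ≤ e m) (hea : ∀ m, e (m + 1) ≤ e m)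
    (hεt : ∀ m, N < m → ε m = 0) (hεrec : ∀ m, ε m = e m - RA 1 ε m) : ∀ m, 0 ≤ ε m ∧ ε m ≤ e m :=
  flow_nonneg_census_young_pair_old_triple_of_cap hmono hL hb hlo hdom hh hf hg hgF hk2 hk29 (by omega) (by omega) (by omega) hk5K
    (s := 41 / 50) (κ := 1 / 1000) (ρ₀ := 92) (by norm_num) (by norm_num) (by norm_num) (by norm_num) (by norm_num) hk3
    (fun q => old_triple_load_le_c38 hmono hL hb hlo hdom hh hf (by omega) h34l h34h h45l h45h hk5K q) hLa hKL hRA hKA hKAtop he0 hea hεt hεrec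

/-- **THE CENSUS FIVE AGES `{1, k₂, k₃, k₄, k₅}` ON THE CELL `k₄∕k₃ ∈ (4,8]`, `k₅∕k₄ ∈ (2,3]`:** `2 ≤ k₂ ≤ 29`, `106·k₂ ≤ k₃`: `0 ≤ ε ≤ e` at
every pin, every horizon, every damping of the self-consistent class (§1 with the triple cap `21 / 25` of `old_triple_load_le_c83`, `κ = 1∕1000`,
`ρ₀ = 106`). [folklore] -/
theorem flow_nonneg_census_five_ages_c83
    (hmono : ∀ u v : ℕ → ℝ, SeqBox γ u → SeqBox γ v → (∀ j, u j ≤ v j) → B u ≤ B v)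
    (hL : ∀ k, 0 ≤ L k) (hb : 0 < b) (hlo : ∀ u, SeqBox γ u → b ≤ B u) (hdom : ∀ u, SeqBox γ u → ∑ k ∈ range K, L k * u k ≤ B u)
    (hh : SeqBox γ h) (hf : MemFlow B gIR h) (hg : ∀ t, 0 < g t ∧ g t ≤ 1)
    (hgF : ∀ t, 1 ≤ g t * (1 + ∑ k ∈ range K, L k * h (t + k) ^ 3 / 2))
    {k₂ k₃ k₄ k₅ : ℕ} (hk2 : 2 ≤ k₂) (hk29 : k₂ ≤ 29) (hk3 : 106 * k₂ ≤ k₃)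
    (h34l : 4 * k₃ < k₄) (h34h : k₄ ≤ 8 * k₃) (h45l : 2 * k₄ < k₅) (h45h : k₅ ≤ 3 * k₄) (hk5K : k₅ < K)
    (hLa : ∀ l, l < K → l ≠ 1 → l ≠ k₂ → l ≠ k₃ → l ≠ k₄ → l ≠ k₅ → L l = 0)
    {N : ℕ} {KL : ℕ → ℕ → ℕ → ℝ}
    (hKL : ∀ k n l, KL k n l = if 0 < k ∧ k < K ∧ l < k then L k * h (n + k) ^ 3 / 2 * ∏ t ∈ Ico (n + 1 + l) (n + k + 1), g t else 0)
    {KA : ℕ → ℕ → ℕ → ℝ} {RA : ℕ → (ℕ → ℝ) → ℕ → ℝ}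
    (hRA : ∀ i v m, RA i v m = ∑ l ∈ range K, KA i m l * v (m + 1 + l))
    (hKA : ∀ i m l, KA i m l = KL i m l + KA (i + 1) m l) (hKAtop : ∀ m l, KA K m l = 0)
    {e ε : ℕ → ℝ} (he0 : ∀ m, 0 ≤ e m) (hea : ∀ m, e (m + 1) ≤ e m)
    (hεt : ∀ m, N < m → ε m = 0) (hεrec : ∀ m, ε m = e m - RA 1 ε m) : ∀ m, 0 ≤ ε m ∧ ε m ≤ e m :=
  flow_nonneg_census_young_pair_old_triple_of_cap hmono hL hb hlo hdom hh hf hg hgF hk2 hk29 (by omega) (by omega) (by omega) hk5K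
    (s := 21 / 25) (κ := 1 / 1000) (ρ₀ := 106) (by norm_num) (by norm_num) (by norm_num) (by norm_num) (by norm_num) hk3
    (fun q => old_triple_load_le_c83 hmono hL hb hlo hdom hh hf (by omega) h34l h34h h45l h45h hk5K q) hLa hKL hRA hKA hKAtop he0 hea hεt hεrec

/-- **THE CENSUS FIVE AGES `{1, k₂, k₃, k₄, k₅}` ON THE CELL `k₄∕k₃ ∈ (3,4]`, `k₅∕k₄ ∈ (4,8]`:** `2 ≤ k₂ ≤ 29`, `106·k₂ ≤ k₃`: `0 ≤ ε ≤ e` at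
every pin, every horizon, every damping of the self-consistent class (§1 with the triple cap `21 / 25` of `old_triple_load_le_c48`, `κ = 1∕1000`,
`ρ₀ = 106`). [folklore] -/
theorem flow_nonneg_census_five_ages_c48
    (hmono : ∀ u v : ℕ → ℝ, SeqBox γ u → SeqBox γ v → (∀ j, u j ≤ v j) → B u ≤ B v)
    (hL : ∀ k, 0 ≤ L k) (hb : 0 < b) (hlo : ∀ u, SeqBox γ u → b ≤ B u) (hdom : ∀ u, SeqBox γ u → ∑ k ∈ range K, L k * u k ≤ B u)
    (hh : SeqBox γ h) (hf : MemFlow B gIR h) (hg : ∀ t, 0 < g t ∧ g t ≤ 1)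
    (hgF : ∀ t, 1 ≤ g t * (1 + ∑ k ∈ range K, L k * h (t + k) ^ 3 / 2))
    {k₂ k₃ k₄ k₅ : ℕ} (hk2 : 2 ≤ k₂) (hk29 : k₂ ≤ 29) (hk3 : 106 * k₂ ≤ k₃)
    (h34l : 3 * k₃ < k₄) (h34h : k₄ ≤ 4 * k₃) (h45l : 4 * k₄ < k₅) (h45h : k₅ ≤ 8 * k₄) (hk5K : k₅ < K)
    (hLa : ∀ l, l < K → l ≠ 1 → l ≠ k₂ → l ≠ k₃ → l ≠ k₄ → l ≠ k₅ → L l = 0)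
    {N : ℕ} {KL : ℕ → ℕ → ℕ → ℝ}
    (hKL : ∀ k n l, KL k n l = if 0 < k ∧ k < K ∧ l < k then L k * h (n + k) ^ 3 / 2 * ∏ t ∈ Ico (n + 1 + l) (n + k + 1), g t else 0)
    {KA : ℕ → ℕ → ℕ → ℝ} {RA : ℕ → (ℕ → ℝ) → ℕ → ℝ}
    (hRA : ∀ i v m, RA i v m = ∑ l ∈ range K, KA i m l * v (m + 1 + l))
    (hKA : ∀ i m l, KA i m l = KL i m l + KA (i + 1) m l) (hKAtop : ∀ m l, KA K m l = 0)
    {e ε : ℕ → ℝ} (he0 : ∀ m, 0 ≤ e m) (hea : ∀ m, e (m + 1) ≤ e m)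
    (hεt : ∀ m, N < m → ε m = 0) (hεrec : ∀ m, ε m = e m - RA 1 ε m) : ∀ m, 0 ≤ ε m ∧ ε m ≤ e m :=
  flow_nonneg_census_young_pair_old_triple_of_cap hmono hL hb hlo hdom hh hf hg hgF hk2 hk29 (by omega) (by omega) (by omega) hk5K
    (s := 21 / 25) (κ := 1 / 1000) (ρ₀ := 106) (by norm_num) (by norm_num) (by norm_num) (by norm_num) (by norm_num) hk3
    (fun q => old_triple_load_le_c48 hmono hL hb hlo hdom hh hf (by omega) h34l h34h h45l h45h hk5K q) hLa hKL hRA hKA hKAtop he0 hea hεt hεrec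

/-- **THE CENSUS FIVE AGES `{1, k₂, k₃, k₄, k₅}` ON THE CELL `k₄∕k₃ ∈ (4,8]`, `k₅∕k₄ ∈ (3,4]`:** `2 ≤ k₂ ≤ 29`, `115·k₂ ≤ k₃`: `0 ≤ ε ≤ e` at
every pin, every horizon, every damping of the self-consistent class (§1 with the triple cap `17 / 20` of `old_triple_load_le_c84`, `κ = 1∕1000`,
`ρ₀ = 115`). [folklore] -/
theorem flow_nonneg_census_five_ages_c84
    (hmono : ∀ u v : ℕ → ℝ, SeqBox γ u → SeqBox γ v → (∀ j, u j ≤ v j) → B u ≤ B v)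
    (hL : ∀ k, 0 ≤ L k) (hb : 0 < b) (hlo : ∀ u, SeqBox γ u → b ≤ B u) (hdom : ∀ u, SeqBox γ u → ∑ k ∈ range K, L k * u k ≤ B u)
    (hh : SeqBox γ h) (hf : MemFlow B gIR h) (hg : ∀ t, 0 < g t ∧ g t ≤ 1)
    (hgF : ∀ t, 1 ≤ g t * (1 + ∑ k ∈ range K, L k * h (t + k) ^ 3 / 2))
    {k₂ k₃ k₄ k₅ : ℕ} (hk2 : 2 ≤ k₂) (hk29 : k₂ ≤ 29) (hk3 : 115 * k₂ ≤ k₃)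
    (h34l : 4 * k₃ < k₄) (h34h : k₄ ≤ 8 * k₃) (h45l : 3 * k₄ < k₅) (h45h : k₅ ≤ 4 * k₄) (hk5K : k₅ < K)
    (hLa : ∀ l, l < K → l ≠ 1 → l ≠ k₂ → l ≠ k₃ → l ≠ k₄ → l ≠ k₅ → L l = 0)
    {N : ℕ} {KL : ℕ → ℕ → ℕ → ℝ}
    (hKL : ∀ k n l, KL k n l = if 0 < k ∧ k < K ∧ l < k then L k * h (n + k) ^ 3 / 2 * ∏ t ∈ Ico (n + 1 + l) (n + k + 1), g t else 0)
    {KA : ℕ → ℕ → ℕ → ℝ} {RA : ℕ → (ℕ → ℝ) → ℕ → ℝ}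
    (hRA : ∀ i v m, RA i v m = ∑ l ∈ range K, KA i m l * v (m + 1 + l))
    (hKA : ∀ i m l, KA i m l = KL i m l + KA (i + 1) m l) (hKAtop : ∀ m l, KA K m l = 0)
    {e ε : ℕ → ℝ} (he0 : ∀ m, 0 ≤ e m) (hea : ∀ m, e (m + 1) ≤ e m)
    (hεt : ∀ m, N < m → ε m = 0) (hεrec : ∀ m, ε m = e m - RA 1 ε m) : ∀ m, 0 ≤ ε m ∧ ε m ≤ e m :=
  flow_nonneg_census_young_pair_old_triple_of_cap hmono hL hb hlo hdom hh hf hg hgF hk2 hk29 (by omega) (by omega) (by omega) hk5K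
    (s := 17 / 20) (κ := 1 / 1000) (ρ₀ := 115) (by norm_num) (by norm_num) (by norm_num) (by norm_num) (by norm_num) hk3
    (fun q => old_triple_load_le_c84 hmono hL hb hlo hdom hh hf (by omega) h34l h34h h45l h45h hk5K q) hLa hKL hRA hKA hKAtop he0 hea hεt hεrec

/-- **THE CENSUS FIVE AGES `{1, k₂, k₃, k₄, k₅}` ON THE CELL `k₄∕k₃ ∈ (4,8]`, `k₅∕k₄ ∈ (4,8]`:** `2 ≤ k₂ ≤ 29`, `233·k₂ ≤ k₃`: `0 ≤ ε ≤ e` at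
every pin, every horizon, every damping of the self-consistent class (§1 with the triple cap `23 / 25` of `old_triple_load_le_c88`, `κ = 1∕1000`,
`ρ₀ = 233`). [folklore] -/
theorem flow_nonneg_census_five_ages_c88
    (hmono : ∀ u v : ℕ → ℝ, SeqBox γ u → SeqBox γ v → (∀ j, u j ≤ v j) → B u ≤ B v)
    (hL : ∀ k, 0 ≤ L k) (hb : 0 < b) (hlo : ∀ u, SeqBox γ u → b ≤ B u) (hdom : ∀ u, SeqBox γ u → ∑ k ∈ range K, L k * u k ≤ B u)
    (hh : SeqBox γ h) (hf : MemFlow B gIR h) (hg : ∀ t, 0 < g t ∧ g t ≤ 1)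
    (hgF : ∀ t, 1 ≤ g t * (1 + ∑ k ∈ range K, L k * h (t + k) ^ 3 / 2))
    {k₂ k₃ k₄ k₅ : ℕ} (hk2 : 2 ≤ k₂) (hk29 : k₂ ≤ 29) (hk3 : 233 * k₂ ≤ k₃)
    (h34l : 4 * k₃ < k₄) (h34h : k₄ ≤ 8 * k₃) (h45l : 4 * k₄ < k₅) (h45h : k₅ ≤ 8 * k₄) (hk5K : k₅ < K)
    (hLa : ∀ l, l < K → l ≠ 1 → l ≠ k₂ → l ≠ k₃ → l ≠ k₄ → l ≠ k₅ → L l = 0)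
    {N : ℕ} {KL : ℕ → ℕ → ℕ → ℝ}
    (hKL : ∀ k n l, KL k n l = if 0 < k ∧ k < K ∧ l < k then L k * h (n + k) ^ 3 / 2 * ∏ t ∈ Ico (n + 1 + l) (n + k + 1), g t else 0)
    {KA : ℕ → ℕ → ℕ → ℝ} {RA : ℕ → (ℕ → ℝ) → ℕ → ℝ}
    (hRA : ∀ i v m, RA i v m = ∑ l ∈ range K, KA i m l * v (m + 1 + l))
    (hKA : ∀ i m l, KA i m l = KL i m l + KA (i + 1) m l) (hKAtop : ∀ m l, KA K m l = 0)
    {e ε : ℕ → ℝ} (he0 : ∀ m, 0 ≤ e m) (hea : ∀ m, e (m + 1) ≤ e m)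
    (hεt : ∀ m, N < m → ε m = 0) (hεrec : ∀ m, ε m = e m - RA 1 ε m) : ∀ m, 0 ≤ ε m ∧ ε m ≤ e m :=
  flow_nonneg_census_young_pair_old_triple_of_cap hmono hL hb hlo hdom hh hf hg hgF hk2 hk29 (by omega) (by omega) (by omega) hk5K
    (s := 23 / 25) (κ := 1 / 1000) (ρ₀ := 233) (by norm_num) (by norm_num) (by norm_num) (by norm_num) (by norm_num) hk3
    (fun q => old_triple_load_le_c88 hmono hL hb hlo hdom hh hf (by omega) h34l h34h h45l h45h hk5K q) hLa hKL hRA hKA hKAtop he0 hea hεt hεrec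

/-! ## §2 Both top ratios at most 8 -/

/-- **THE CENSUS FIVE AGES, BOTH TOP RATIOS AT MOST 8.**  `2 ≤ k₂ ≤ 29`, `233k₂ ≤ k₃`, `k₃ < k₄ ≤ 8k₃`, `k₄ < k₅ ≤ 8k₄`, `k₅ < K`: `0 ≤ ε ≤ e` at every
pin, every horizon, every damping of the self-consistent class ((E104a) `…_top4` and the seven cells of §1). [folklore] -/
theorem flow_nonneg_census_five_ages_top8
    (hmono : ∀ u v : ℕ → ℝ, SeqBox γ u → SeqBox γ v → (∀ j, u j ≤ v j) → B u ≤ B v)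
    (hL : ∀ k, 0 ≤ L k) (hb : 0 < b) (hlo : ∀ u, SeqBox γ u → b ≤ B u) (hdom : ∀ u, SeqBox γ u → ∑ k ∈ range K, L k * u k ≤ B u)
    (hh : SeqBox γ h) (hf : MemFlow B gIR h) (hg : ∀ t, 0 < g t ∧ g t ≤ 1)
    (hgF : ∀ t, 1 ≤ g t * (1 + ∑ k ∈ range K, L k * h (t + k) ^ 3 / 2))
    {k₂ k₃ k₄ k₅ : ℕ} (hk2 : 2 ≤ k₂) (hk29 : k₂ ≤ 29) (hk3 : 233 * k₂ ≤ k₃)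
    (h34l : k₃ < k₄) (h34h : k₄ ≤ 8 * k₃) (h45l : k₄ < k₅) (h45h : k₅ ≤ 8 * k₄) (hk5K : k₅ < K)
    (hLa : ∀ l, l < K → l ≠ 1 → l ≠ k₂ → l ≠ k₃ → l ≠ k₄ → l ≠ k₅ → L l = 0)
    {N : ℕ} {KL : ℕ → ℕ → ℕ → ℝ}
    (hKL : ∀ k n l, KL k n l = if 0 < k ∧ k < K ∧ l < k then L k * h (n + k) ^ 3 / 2 * ∏ t ∈ Ico (n + 1 + l) (n + k + 1), g t else 0)
    {KA : ℕ → ℕ → ℕ → ℝ} {RA : ℕ → (ℕ → ℝ) → ℕ → ℝ}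
    (hRA : ∀ i v m, RA i v m = ∑ l ∈ range K, KA i m l * v (m + 1 + l))
    (hKA : ∀ i m l, KA i m l = KL i m l + KA (i + 1) m l) (hKAtop : ∀ m l, KA K m l = 0)
    {e ε : ℕ → ℝ} (he0 : ∀ m, 0 ≤ e m) (hea : ∀ m, e (m + 1) ≤ e m)
    (hεt : ∀ m, N < m → ε m = 0) (hεrec : ∀ m, ε m = e m - RA 1 ε m) : ∀ m, 0 ≤ ε m ∧ ε m ≤ e m := by
  rcases le_or_gt k₄ (4 * k₃) with ha | ha
  · rcases le_or_gt k₅ (4 * k₄) with hb' | hb'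
    · exact flow_nonneg_census_five_ages_top4 hmono hL hb hlo hdom hh hf hg hgF hk2 hk29 (by omega) h34l ha h45l hb' hk5K hLa
        hKL hRA hKA hKAtop he0 hea hεt hεrec
    rcases le_or_gt k₄ (2 * k₃) with h2 | h2
    · exact flow_nonneg_census_five_ages_c28 hmono hL hb hlo hdom hh hf hg hgF hk2 hk29 (by omega) (by omega) h2 (by omega) h45h hk5K hLa
        hKL hRA hKA hKAtop he0 hea hεt hεrec
    rcases le_or_gt k₄ (3 * k₃) with h3 | h3
    · exact flow_nonneg_census_five_ages_c38 hmono hL hb hlo hdom hh hf hg hgF hk2 hk29 (by omega) (by omega) h3 (by omega) h45h hk5K hLa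
        hKL hRA hKA hKAtop he0 hea hεt hεrec
    · exact flow_nonneg_census_five_ages_c48 hmono hL hb hlo hdom hh hf hg hgF hk2 hk29 (by omega) (by omega) ha (by omega) h45h hk5K hLa
        hKL hRA hKA hKAtop he0 hea hεt hεrec
  rcases le_or_gt k₅ (2 * k₄) with h2 | h2
  · exact flow_nonneg_census_five_ages_c82 hmono hL hb hlo hdom hh hf hg hgF hk2 hk29 (by omega) (by omega) h34h (by omega) h2 hk5K hLa
      hKL hRA hKA hKAtop he0 hea hεt hεrec
  rcases le_or_gt k₅ (3 * k₄) with h3 | h3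
  · exact flow_nonneg_census_five_ages_c83 hmono hL hb hlo hdom hh hf hg hgF hk2 hk29 (by omega) (by omega) h34h (by omega) h3 hk5K hLa
      hKL hRA hKA hKAtop he0 hea hεt hεrec
  rcases le_or_gt k₅ (4 * k₄) with h4 | h4
  · exact flow_nonneg_census_five_ages_c84 hmono hL hb hlo hdom hh hf hg hgF hk2 hk29 (by omega) (by omega) h34h (by omega) h4 hk5K hLa
      hKL hRA hKA hKAtop he0 hea hεt hεrec
  · exact flow_nonneg_census_five_ages_c88 hmono hL hb hlo hdom hh hf hg hgF hk2 hk29 (by omega) (by omega) h34h (by omega) h45h hk5K hLa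
      hKL hRA hKA hKAtop he0 hea hεt hεrec

end Summit.QuantumFields.BalabanUV.Beta.EriceRemainderEnclosureHistoryAutonomyComparisonAgeCompositionFiveAgesOneBlockWide
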